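import Mathlib
import Summits.AnomalousDissipation.AnomalousDissipation.Theses.DyadicWallCascade
import Summits.AnomalousDissipation.AnomalousDissipation.Theses.CoherentStates

/-!
# Load-bearing clauses of the antecedent of `DyadicWallCascade.DyadicRealisation`
# (negative lemmas for the crux stmt-AnomalousDissipation-17918; disprover seat cdisprove-17918)

Refuter file, Negative lane (D-0016), route `DyadicWallCascade` of `Summits/AnomalousDissipation`,
sub-problem `AnomalousDissipation`.

The crux `DyadicRealisation` is `A → Z` with `A` = the clause block of the support decl
`ViscousWallProfile` (a half-space hierarchy `(V, Q, C, F)` — the block of crux #2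
`HalfSpaceHierarchy` — together with a viscous cap `(W, P, C')` blowing down to it) and `Z` =
`CoherentStates.SteadyZerothLaw` (stmt-0219) verbatim.  Since `Z` is the open summit-level steady
zeroth law, no lemma of the shape `¬(A⁻ → Z)` (crux with a clause of `A` deleted) is available to
anybody: it would contain a proof of `¬Z`.  The honest load-bearing analysis of an implication with
an open consequent is instead: WHICH CLAUSES KEEP `A` FROM BEING INHABITED BY JUNK?  Delete such a
clause and the crux degenerates to `Z` itself — the hypothesis then hands the prover nothing.

Kernel-checked here (all witnesses are the zero flow; `Z` is referred to BY NAME,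
`CoherentStates.SteadyZerothLaw`, which type-checks only because the crux's consequent is that
decl's body verbatim — `not_steadyZerothLaw_of_not_dyadicRealisation` is the machine check):

* `inhabited_without_fluxNonzero` — delete `F ≠ 0`: `W = P = V = Q = 0`, `C = C' = F = 0`
  satisfies every other clause (smoothness, bounds, divergence, Euler, dilation, periodicity,
  mirror symmetry, Navier–Stokes, blow-down, zero mass flux, flux integral `= F = 0`).
  Hence `imp_iff_of_without_fluxNonzero`: `(A minus "F ≠ 0" → X) ↔ X` for every `X`, in
  particular the crux without `F ≠ 0` IS stmt-0219.
* `inhabited_without_fluxIntegral` — delete the energy-flux clause `∫ V₂(|V|²/2+Q) = F`: the same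
  zeros with `F = 1`.  Hence `imp_iff_of_without_fluxIntegral`.
* `without_blowdown_iff_hierarchy` — delete the blow-down clause (the ONLY clause coupling `W` to
  `V`): the block is inhabited iff the hierarchy block alone is (`W = P = 0`, `C' = 0` caps any
  hierarchy), i.e. iff crux #2 `HalfSpaceHierarchy` holds (stated with #2's block written out, so
  that no positive edge on a route item is created); hence `imp_iff_of_without_blowdown`: the crux
  without the blow-down clause is `HalfSpaceHierarchy → SteadyZerothLaw` — the viscous profile
  then carries no information at all.

Not deletable by junk (recorded for the provers; each deletion leaves an OPEN existence problem
inside `A`, so neither an inhabitant nor an emptiness proof is available):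
* delete any ONE of: a smoothness / bound / divergence / Euler / dilation / periodicity clause of
  the `V`-block, the zero-mass-flux clause, the pressure bound or the mirror clause of the
  `W`-block — the remaining block still contains `{W smooth, ‖W‖ ≤ C', div W = 0, steady NS,
  W-blow-down, F ≠ 0, flux = F}` plus one of `{zero mass flux, mirror symmetry}`, and this forces
  `W` to be NON-CONSTANT (a constant `W ≡ b` blows down to `V ≡ b` on the band; `b₂ = 0` by zero
  mass flux, or by mirror symmetry `b₂ = −b₂` when the mass clause is the deleted one; then the
  energy-flux integrand vanishes and `F = 0`): a non-constant velocity-bounded smooth entire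
  steady Navier–Stokes flow, i.e. a counterexample to the steady case of the KNSS Liouville
  conjecture — see the sibling file `ViscousWallProfileFalseOfLiouvilleConjectureNS.lean`
  (`LiouvilleConjectureNS → ¬ViscousWallProfile`, which uses only those clauses);
* delete the velocity bound of `W`: a non-constant smooth entire steady flow, bounded on the
  blown-up bands `2^m · {1 ≤ X₂ ≤ 2}` for large `m`; the explicit unbounded entire flows (linear
  and polynomial strains) have divergent blow-downs — no junk known;
* delete the `W`-smoothness clause: with `W` merely a function the `fderiv` clauses are
  junk-satisfiable (nowhere-differentiable `W`), but the Navier–Stokes clause then reads `∇P = 0`,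
  so `P` is constant, the pressure half of the blow-down forces `Q` constant, and the hierarchy must
  satisfy `(V·∇)V = 0` with `F ≠ 0` — a flux-carrying hierarchy with straight streamlines, not known
  to exist either;
* delete the `W`-divergence or the `W`-Navier–Stokes clause: gradient fields `W = ∇φ`
  (`P = Δφ − |∇φ|²/2`) resp. solenoidal mirror extensions of `V` would inhabit the `W`-half, but
  the intact `V`-half is crux #2 `HalfSpaceHierarchy` (open; and potential hierarchies are excluded,
  `DyadicRealisationLambVector.lean`);
So exactly three clauses are cheap-load-bearing: `F ≠ 0`, the flux integral, and the blow-down;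
everything else is guarded by crux #2 or by the Liouville problem.

Two silent normalisations hidden in single clauses are recorded at the end (consequences, not
kills): `wallSlip_of_mirror` — the mirror clause makes the symmetry plane a free-slip wall
(`W₂ = 0` on `X₂ = 0`); `halfPeriod_at_one` — the CLOSED band plus dilation invariance give
`V(·,·,1)` the horizontal period `½`, so the unit square of the flux clauses holds four minimal
cells (`F = 4 F_cell`).
-/

open scoped BigOperators Topology
open Filter Set MeasureTheory

-- `Summit.<Summit>.<Problem>` is the tree's mandated summit-side namespace (CONVENTIONS §2); for this
-- single-conjunct summit the two coincide, so the duplicate is deliberate.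
set_option linter.dupNamespace false

namespace Summit.AnomalousDissipation.AnomalousDissipation.Theorems

namespace DyadicWallCascadeNegative

/-- **Delete `F ≠ 0` and the antecedent is inhabited by the zero flow.**  The clause block of
`ViscousWallProfile` with the single clause `F ≠ 0` removed holds for `W = P = V = Q = 0`,
`C = F = C' = 0`. [folklore] -/
theorem inhabited_without_fluxNonzero :
    ∃ (W : EuclideanSpace ℝ (Fin 3) → EuclideanSpace ℝ (Fin 3)) (P : EuclideanSpace ℝ (Fin 3) → ℝ)
    (V : EuclideanSpace ℝ (Fin 3) → EuclideanSpace ℝ (Fin 3)) (Q : EuclideanSpace ℝ (Fin 3) → ℝ) (C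
    F C' : ℝ),
      let H : Set (EuclideanSpace ℝ (Fin 3)) := {X | 0 < X 2};
      let e : Fin 3 → EuclideanSpace ℝ (Fin 3) := fun i => EuclideanSpace.single i (1 : ℝ);
      let pt : ℝ × ℝ → EuclideanSpace ℝ (Fin 3) := fun q => !₂[q.1, q.2, (1 : ℝ)];
      let σ : EuclideanSpace ℝ (Fin 3) → EuclideanSpace ℝ (Fin 3) := fun X => X - (2 * X 2) • e 2;
      (ContDiffOn ℝ ((⊤ : ℕ∞) : WithTop ℕ∞) V H ∧ ContDiffOn ℝ ((⊤ : ℕ∞) : WithTop ℕ∞) Q H ∧ (∀ X ∈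
      H, ‖V X‖ ≤ C ∧ |Q X| ≤ C) ∧ (∀ X ∈ H, ∑ i : Fin 3, (fderiv ℝ V X (e i)) i = 0) ∧ (∀ X ∈ H,
      (fderiv ℝ V X) (V X) + gradient Q X = 0) ∧ (∀ X ∈ H, V ((2 : ℝ) • X) = V X ∧ Q ((2 : ℝ) • X)
      = Q X) ∧ (∀ X : EuclideanSpace ℝ (Fin 3), 1 ≤ X 2 → X 2 ≤ 2 → V (X + e 0) = V X ∧ V (X + e 1)
      = V X ∧ Q (X + e 0) = Q X ∧ Q (X + e 1) = Q X) ∧ (∫ q in Set.Icc (0 : ℝ) 1 ×ˢ Set.Icc (0 : ℝ)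
      1, (V (pt q)) 2 = 0) ∧ (∫ q in Set.Icc (0 : ℝ) 1 ×ˢ Set.Icc (0 : ℝ) 1, (V (pt q)) 2 * (‖V (pt
      q)‖ ^ 2 / 2 + Q (pt q)) = F)) ∧ ContDiff ℝ ((⊤ : ℕ∞) : WithTop ℕ∞) W ∧ ContDiff ℝ ((⊤ : ℕ∞) :
      WithTop ℕ∞) P ∧ (∀ X, ‖W X‖ ≤ C' ∧ |P X| ≤ C') ∧ (∀ X, W (σ X) = σ (W X) ∧ P (σ X) = P X) ∧
      (∀ X, ∑ i : Fin 3, (fderiv ℝ W X (e i)) i = 0) ∧ (∀ X, (fderiv ℝ W X) (W X) + gradient P X =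
      ∑ i : Fin 3, fderiv ℝ (fun Y => fderiv ℝ W Y (e i)) X (e i)) ∧ (∀ ε : ℝ, 0 < ε → ∃ M : ℕ, ∀ m
      : ℕ, M ≤ m → ∀ X : EuclideanSpace ℝ (Fin 3), 1 ≤ X 2 → X 2 ≤ 2 → ‖W ((2 : ℝ) ^ m • X) - V X‖
      ≤ ε ∧ |P ((2 : ℝ) ^ m • X) - Q X| ≤ ε) := by
  refine ⟨0, 0, 0, 0, 0, 0, 0, ?_⟩
  simp only [gradient]
  simp
  exact ⟨⟨contDiffOn_const, contDiffOn_const⟩, contDiff_const, contDiff_const,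
    fun ε hε => ⟨0, fun _ _ _ _ _ => hε.le⟩⟩

/-- **Delete the energy-flux clause and the antecedent is inhabited by the zero flow** (with
`F = 1`). [folklore] -/
theorem inhabited_without_fluxIntegral :
    ∃ (W : EuclideanSpace ℝ (Fin 3) → EuclideanSpace ℝ (Fin 3)) (P : EuclideanSpace ℝ (Fin 3) → ℝ)
    (V : EuclideanSpace ℝ (Fin 3) → EuclideanSpace ℝ (Fin 3)) (Q : EuclideanSpace ℝ (Fin 3) → ℝ) (C
    F C' : ℝ),
      let H : Set (EuclideanSpace ℝ (Fin 3)) := {X | 0 < X 2};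
      let e : Fin 3 → EuclideanSpace ℝ (Fin 3) := fun i => EuclideanSpace.single i (1 : ℝ);
      let pt : ℝ × ℝ → EuclideanSpace ℝ (Fin 3) := fun q => !₂[q.1, q.2, (1 : ℝ)];
      let σ : EuclideanSpace ℝ (Fin 3) → EuclideanSpace ℝ (Fin 3) := fun X => X - (2 * X 2) • e 2;
      (ContDiffOn ℝ ((⊤ : ℕ∞) : WithTop ℕ∞) V H ∧ ContDiffOn ℝ ((⊤ : ℕ∞) : WithTop ℕ∞) Q H ∧ (∀ X ∈
      H, ‖V X‖ ≤ C ∧ |Q X| ≤ C) ∧ (∀ X ∈ H, ∑ i : Fin 3, (fderiv ℝ V X (e i)) i = 0) ∧ (∀ X ∈ H,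
      (fderiv ℝ V X) (V X) + gradient Q X = 0) ∧ (∀ X ∈ H, V ((2 : ℝ) • X) = V X ∧ Q ((2 : ℝ) • X)
      = Q X) ∧ (∀ X : EuclideanSpace ℝ (Fin 3), 1 ≤ X 2 → X 2 ≤ 2 → V (X + e 0) = V X ∧ V (X + e 1)
      = V X ∧ Q (X + e 0) = Q X ∧ Q (X + e 1) = Q X) ∧ (∫ q in Set.Icc (0 : ℝ) 1 ×ˢ Set.Icc (0 : ℝ)
      1, (V (pt q)) 2 = 0) ∧ F ≠ 0) ∧ ContDiff ℝ ((⊤ : ℕ∞) : WithTop ℕ∞) W ∧ ContDiff ℝ ((⊤ : ℕ∞) :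
      WithTop ℕ∞) P ∧ (∀ X, ‖W X‖ ≤ C' ∧ |P X| ≤ C') ∧ (∀ X, W (σ X) = σ (W X) ∧ P (σ X) = P X) ∧
      (∀ X, ∑ i : Fin 3, (fderiv ℝ W X (e i)) i = 0) ∧ (∀ X, (fderiv ℝ W X) (W X) + gradient P X =
      ∑ i : Fin 3, fderiv ℝ (fun Y => fderiv ℝ W Y (e i)) X (e i)) ∧ (∀ ε : ℝ, 0 < ε → ∃ M : ℕ, ∀ m
      : ℕ, M ≤ m → ∀ X : EuclideanSpace ℝ (Fin 3), 1 ≤ X 2 → X 2 ≤ 2 → ‖W ((2 : ℝ) ^ m • X) - V X‖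
      ≤ ε ∧ |P ((2 : ℝ) ^ m • X) - Q X| ≤ ε) := by
  refine ⟨0, 0, 0, 0, 0, 1, 0, ?_⟩
  simp only [gradient]
  simp
  exact ⟨⟨contDiffOn_const, contDiffOn_const⟩, contDiff_const, contDiff_const,
    fun ε hε => ⟨0, fun _ _ _ _ _ => hε.le⟩⟩

/-- **Delete the blow-down clause and the viscous cap decouples**: the block without its last
clause is inhabited iff the hierarchy block of crux #2 (`HalfSpaceHierarchy`, written out) is —
cap any hierarchy with `W = P = 0`, `C' = 0`. [folklore] -/
theorem without_blowdown_iff_hierarchy :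
    (∃ (W : EuclideanSpace ℝ (Fin 3) → EuclideanSpace ℝ (Fin 3)) (P : EuclideanSpace ℝ (Fin 3) → ℝ)
    (V : EuclideanSpace ℝ (Fin 3) → EuclideanSpace ℝ (Fin 3)) (Q : EuclideanSpace ℝ (Fin 3) → ℝ) (C
    F C' : ℝ),
      let H : Set (EuclideanSpace ℝ (Fin 3)) := {X | 0 < X 2};
      let e : Fin 3 → EuclideanSpace ℝ (Fin 3) := fun i => EuclideanSpace.single i (1 : ℝ);
      let pt : ℝ × ℝ → EuclideanSpace ℝ (Fin 3) := fun q => !₂[q.1, q.2, (1 : ℝ)];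
      let σ : EuclideanSpace ℝ (Fin 3) → EuclideanSpace ℝ (Fin 3) := fun X => X - (2 * X 2) • e 2;
      (ContDiffOn ℝ ((⊤ : ℕ∞) : WithTop ℕ∞) V H ∧ ContDiffOn ℝ ((⊤ : ℕ∞) : WithTop ℕ∞) Q H ∧ (∀ X ∈
      H, ‖V X‖ ≤ C ∧ |Q X| ≤ C) ∧ (∀ X ∈ H, ∑ i : Fin 3, (fderiv ℝ V X (e i)) i = 0) ∧ (∀ X ∈ H,
      (fderiv ℝ V X) (V X) + gradient Q X = 0) ∧ (∀ X ∈ H, V ((2 : ℝ) • X) = V X ∧ Q ((2 : ℝ) • X)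
      = Q X) ∧ (∀ X : EuclideanSpace ℝ (Fin 3), 1 ≤ X 2 → X 2 ≤ 2 → V (X + e 0) = V X ∧ V (X + e 1)
      = V X ∧ Q (X + e 0) = Q X ∧ Q (X + e 1) = Q X) ∧ (∫ q in Set.Icc (0 : ℝ) 1 ×ˢ Set.Icc (0 : ℝ)
      1, (V (pt q)) 2 = 0) ∧ F ≠ 0 ∧ (∫ q in Set.Icc (0 : ℝ) 1 ×ˢ Set.Icc (0 : ℝ) 1, (V (pt q)) 2 *
      (‖V (pt q)‖ ^ 2 / 2 + Q (pt q)) = F)) ∧ ContDiff ℝ ((⊤ : ℕ∞) : WithTop ℕ∞) W ∧ ContDiff ℝ ((⊤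
      : ℕ∞) : WithTop ℕ∞) P ∧ (∀ X, ‖W X‖ ≤ C' ∧ |P X| ≤ C') ∧ (∀ X, W (σ X) = σ (W X) ∧ P (σ X) =
      P X) ∧ (∀ X, ∑ i : Fin 3, (fderiv ℝ W X (e i)) i = 0) ∧ (∀ X, (fderiv ℝ W X) (W X) + gradient
      P X = ∑ i : Fin 3, fderiv ℝ (fun Y => fderiv ℝ W Y (e i)) X (e i))) ↔
    (∃ (V : EuclideanSpace ℝ (Fin 3) → EuclideanSpace ℝ (Fin 3)) (Q : EuclideanSpace ℝ (Fin 3) → ℝ)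
    (C F : ℝ),
      let H : Set (EuclideanSpace ℝ (Fin 3)) := {X | 0 < X 2};
      let e : Fin 3 → EuclideanSpace ℝ (Fin 3) := fun i => EuclideanSpace.single i (1 : ℝ);
      let pt : ℝ × ℝ → EuclideanSpace ℝ (Fin 3) := fun q => !₂[q.1, q.2, (1 : ℝ)];
      ContDiffOn ℝ ((⊤ : ℕ∞) : WithTop ℕ∞) V H ∧ ContDiffOn ℝ ((⊤ : ℕ∞) : WithTop ℕ∞) Q H ∧ (∀ X ∈
      H, ‖V X‖ ≤ C ∧ |Q X| ≤ C) ∧ (∀ X ∈ H, ∑ i : Fin 3, (fderiv ℝ V X (e i)) i = 0) ∧ (∀ X ∈ H,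
      (fderiv ℝ V X) (V X) + gradient Q X = 0) ∧ (∀ X ∈ H, V ((2 : ℝ) • X) = V X ∧ Q ((2 : ℝ) • X)
      = Q X) ∧ (∀ X : EuclideanSpace ℝ (Fin 3), 1 ≤ X 2 → X 2 ≤ 2 → V (X + e 0) = V X ∧ V (X + e 1)
      = V X ∧ Q (X + e 0) = Q X ∧ Q (X + e 1) = Q X) ∧ (∫ q in Set.Icc (0 : ℝ) 1 ×ˢ Set.Icc (0 : ℝ)
      1, (V (pt q)) 2 = 0) ∧ F ≠ 0 ∧ (∫ q in Set.Icc (0 : ℝ) 1 ×ˢ Set.Icc (0 : ℝ) 1, (V (pt q)) 2 *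
      (‖V (pt q)‖ ^ 2 / 2 + Q (pt q)) = F)) := by
  constructor
  · rintro ⟨W, P, V, Q, C, F, C', hh⟩
    exact ⟨V, Q, C, F, hh.1⟩
  · rintro ⟨V, Q, C, F, hV⟩
    refine ⟨0, 0, V, Q, C, F, 0, hV, ?_⟩
    simp only [gradient]
    simp
    exact ⟨contDiff_const, contDiff_const⟩

/-- Pure logic: an implication out of an inhabited proposition is its consequent. [folklore]
Deprecated duplicate (dedup-03064) of Mathlib's `imp_iff_right hA`; use that lemma. -/
@[deprecated imp_iff_right (since := "2026-08-17")]
theorem imp_iff_of_inhabited {A X : Prop} (hA : A) : (A → X) ↔ X := imp_iff_right hA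

/-- **The crux without `F ≠ 0` is its own consequent** (take `X := CoherentStates.SteadyZerothLaw`:
the weakened crux is the open summit-level item stmt-0219 itself). [folklore] -/
theorem imp_iff_of_without_fluxNonzero (X : Prop) :
    ((∃ (W : EuclideanSpace ℝ (Fin 3) → EuclideanSpace ℝ (Fin 3)) (P : EuclideanSpace ℝ (Fin 3) →
    ℝ) (V : EuclideanSpace ℝ (Fin 3) → EuclideanSpace ℝ (Fin 3)) (Q : EuclideanSpace ℝ (Fin 3) → ℝ)
    (C F C' : ℝ),
      let H : Set (EuclideanSpace ℝ (Fin 3)) := {X | 0 < X 2};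
      let e : Fin 3 → EuclideanSpace ℝ (Fin 3) := fun i => EuclideanSpace.single i (1 : ℝ);
      let pt : ℝ × ℝ → EuclideanSpace ℝ (Fin 3) := fun q => !₂[q.1, q.2, (1 : ℝ)];
      let σ : EuclideanSpace ℝ (Fin 3) → EuclideanSpace ℝ (Fin 3) := fun X => X - (2 * X 2) • e 2;
      (ContDiffOn ℝ ((⊤ : ℕ∞) : WithTop ℕ∞) V H ∧ ContDiffOn ℝ ((⊤ : ℕ∞) : WithTop ℕ∞) Q H ∧ (∀ X ∈
      H, ‖V X‖ ≤ C ∧ |Q X| ≤ C) ∧ (∀ X ∈ H, ∑ i : Fin 3, (fderiv ℝ V X (e i)) i = 0) ∧ (∀ X ∈ H,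
      (fderiv ℝ V X) (V X) + gradient Q X = 0) ∧ (∀ X ∈ H, V ((2 : ℝ) • X) = V X ∧ Q ((2 : ℝ) • X)
      = Q X) ∧ (∀ X : EuclideanSpace ℝ (Fin 3), 1 ≤ X 2 → X 2 ≤ 2 → V (X + e 0) = V X ∧ V (X + e 1)
      = V X ∧ Q (X + e 0) = Q X ∧ Q (X + e 1) = Q X) ∧ (∫ q in Set.Icc (0 : ℝ) 1 ×ˢ Set.Icc (0 : ℝ)
      1, (V (pt q)) 2 = 0) ∧ (∫ q in Set.Icc (0 : ℝ) 1 ×ˢ Set.Icc (0 : ℝ) 1, (V (pt q)) 2 * (‖V (pt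
      q)‖ ^ 2 / 2 + Q (pt q)) = F)) ∧ ContDiff ℝ ((⊤ : ℕ∞) : WithTop ℕ∞) W ∧ ContDiff ℝ ((⊤ : ℕ∞) :
      WithTop ℕ∞) P ∧ (∀ X, ‖W X‖ ≤ C' ∧ |P X| ≤ C') ∧ (∀ X, W (σ X) = σ (W X) ∧ P (σ X) = P X) ∧
      (∀ X, ∑ i : Fin 3, (fderiv ℝ W X (e i)) i = 0) ∧ (∀ X, (fderiv ℝ W X) (W X) + gradient P X =
      ∑ i : Fin 3, fderiv ℝ (fun Y => fderiv ℝ W Y (e i)) X (e i)) ∧ (∀ ε : ℝ, 0 < ε → ∃ M : ℕ, ∀ m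
      : ℕ, M ≤ m → ∀ X : EuclideanSpace ℝ (Fin 3), 1 ≤ X 2 → X 2 ≤ 2 → ‖W ((2 : ℝ) ^ m • X) - V X‖
      ≤ ε ∧ |P ((2 : ℝ) ^ m • X) - Q X| ≤ ε)) → X) ↔ X :=
  imp_iff_right inhabited_without_fluxNonzero

/-- **The crux without the energy-flux clause is its own consequent.** [folklore] -/
theorem imp_iff_of_without_fluxIntegral (X : Prop) :
    ((∃ (W : EuclideanSpace ℝ (Fin 3) → EuclideanSpace ℝ (Fin 3)) (P : EuclideanSpace ℝ (Fin 3) →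
    ℝ) (V : EuclideanSpace ℝ (Fin 3) → EuclideanSpace ℝ (Fin 3)) (Q : EuclideanSpace ℝ (Fin 3) → ℝ)
    (C F C' : ℝ),
      let H : Set (EuclideanSpace ℝ (Fin 3)) := {X | 0 < X 2};
      let e : Fin 3 → EuclideanSpace ℝ (Fin 3) := fun i => EuclideanSpace.single i (1 : ℝ);
      let pt : ℝ × ℝ → EuclideanSpace ℝ (Fin 3) := fun q => !₂[q.1, q.2, (1 : ℝ)];
      let σ : EuclideanSpace ℝ (Fin 3) → EuclideanSpace ℝ (Fin 3) := fun X => X - (2 * X 2) • e 2;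
      (ContDiffOn ℝ ((⊤ : ℕ∞) : WithTop ℕ∞) V H ∧ ContDiffOn ℝ ((⊤ : ℕ∞) : WithTop ℕ∞) Q H ∧ (∀ X ∈
      H, ‖V X‖ ≤ C ∧ |Q X| ≤ C) ∧ (∀ X ∈ H, ∑ i : Fin 3, (fderiv ℝ V X (e i)) i = 0) ∧ (∀ X ∈ H,
      (fderiv ℝ V X) (V X) + gradient Q X = 0) ∧ (∀ X ∈ H, V ((2 : ℝ) • X) = V X ∧ Q ((2 : ℝ) • X)
      = Q X) ∧ (∀ X : EuclideanSpace ℝ (Fin 3), 1 ≤ X 2 → X 2 ≤ 2 → V (X + e 0) = V X ∧ V (X + e 1)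
      = V X ∧ Q (X + e 0) = Q X ∧ Q (X + e 1) = Q X) ∧ (∫ q in Set.Icc (0 : ℝ) 1 ×ˢ Set.Icc (0 : ℝ)
      1, (V (pt q)) 2 = 0) ∧ F ≠ 0) ∧ ContDiff ℝ ((⊤ : ℕ∞) : WithTop ℕ∞) W ∧ ContDiff ℝ ((⊤ : ℕ∞) :
      WithTop ℕ∞) P ∧ (∀ X, ‖W X‖ ≤ C' ∧ |P X| ≤ C') ∧ (∀ X, W (σ X) = σ (W X) ∧ P (σ X) = P X) ∧
      (∀ X, ∑ i : Fin 3, (fderiv ℝ W X (e i)) i = 0) ∧ (∀ X, (fderiv ℝ W X) (W X) + gradient P X =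
      ∑ i : Fin 3, fderiv ℝ (fun Y => fderiv ℝ W Y (e i)) X (e i)) ∧ (∀ ε : ℝ, 0 < ε → ∃ M : ℕ, ∀ m
      : ℕ, M ≤ m → ∀ X : EuclideanSpace ℝ (Fin 3), 1 ≤ X 2 → X 2 ≤ 2 → ‖W ((2 : ℝ) ^ m • X) - V X‖
      ≤ ε ∧ |P ((2 : ℝ) ^ m • X) - Q X| ≤ ε)) → X) ↔ X :=
  imp_iff_right inhabited_without_fluxIntegral

/-- **The crux without the blow-down clause is `HalfSpaceHierarchy → X`**: the viscous profile
`W` then carries no information. [folklore] -/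
theorem imp_iff_of_without_blowdown (X : Prop) :
    ((∃ (W : EuclideanSpace ℝ (Fin 3) → EuclideanSpace ℝ (Fin 3)) (P : EuclideanSpace ℝ (Fin 3) →
    ℝ) (V : EuclideanSpace ℝ (Fin 3) → EuclideanSpace ℝ (Fin 3)) (Q : EuclideanSpace ℝ (Fin 3) → ℝ)
    (C F C' : ℝ),
      let H : Set (EuclideanSpace ℝ (Fin 3)) := {X | 0 < X 2};
      let e : Fin 3 → EuclideanSpace ℝ (Fin 3) := fun i => EuclideanSpace.single i (1 : ℝ);
      let pt : ℝ × ℝ → EuclideanSpace ℝ (Fin 3) := fun q => !₂[q.1, q.2, (1 : ℝ)];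
      let σ : EuclideanSpace ℝ (Fin 3) → EuclideanSpace ℝ (Fin 3) := fun X => X - (2 * X 2) • e 2;
      (ContDiffOn ℝ ((⊤ : ℕ∞) : WithTop ℕ∞) V H ∧ ContDiffOn ℝ ((⊤ : ℕ∞) : WithTop ℕ∞) Q H ∧ (∀ X ∈
      H, ‖V X‖ ≤ C ∧ |Q X| ≤ C) ∧ (∀ X ∈ H, ∑ i : Fin 3, (fderiv ℝ V X (e i)) i = 0) ∧ (∀ X ∈ H,
      (fderiv ℝ V X) (V X) + gradient Q X = 0) ∧ (∀ X ∈ H, V ((2 : ℝ) • X) = V X ∧ Q ((2 : ℝ) • X)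
      = Q X) ∧ (∀ X : EuclideanSpace ℝ (Fin 3), 1 ≤ X 2 → X 2 ≤ 2 → V (X + e 0) = V X ∧ V (X + e 1)
      = V X ∧ Q (X + e 0) = Q X ∧ Q (X + e 1) = Q X) ∧ (∫ q in Set.Icc (0 : ℝ) 1 ×ˢ Set.Icc (0 : ℝ)
      1, (V (pt q)) 2 = 0) ∧ F ≠ 0 ∧ (∫ q in Set.Icc (0 : ℝ) 1 ×ˢ Set.Icc (0 : ℝ) 1, (V (pt q)) 2 *
      (‖V (pt q)‖ ^ 2 / 2 + Q (pt q)) = F)) ∧ ContDiff ℝ ((⊤ : ℕ∞) : WithTop ℕ∞) W ∧ ContDiff ℝ ((⊤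
      : ℕ∞) : WithTop ℕ∞) P ∧ (∀ X, ‖W X‖ ≤ C' ∧ |P X| ≤ C') ∧ (∀ X, W (σ X) = σ (W X) ∧ P (σ X) =
      P X) ∧ (∀ X, ∑ i : Fin 3, (fderiv ℝ W X (e i)) i = 0) ∧ (∀ X, (fderiv ℝ W X) (W X) + gradient
      P X = ∑ i : Fin 3, fderiv ℝ (fun Y => fderiv ℝ W Y (e i)) X (e i))) → X) ↔
    ((∃ (V : EuclideanSpace ℝ (Fin 3) → EuclideanSpace ℝ (Fin 3)) (Q : EuclideanSpace ℝ (Fin 3) →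
    ℝ) (C F : ℝ),
      let H : Set (EuclideanSpace ℝ (Fin 3)) := {X | 0 < X 2};
      let e : Fin 3 → EuclideanSpace ℝ (Fin 3) := fun i => EuclideanSpace.single i (1 : ℝ);
      let pt : ℝ × ℝ → EuclideanSpace ℝ (Fin 3) := fun q => !₂[q.1, q.2, (1 : ℝ)];
      ContDiffOn ℝ ((⊤ : ℕ∞) : WithTop ℕ∞) V H ∧ ContDiffOn ℝ ((⊤ : ℕ∞) : WithTop ℕ∞) Q H ∧ (∀ X ∈
      H, ‖V X‖ ≤ C ∧ |Q X| ≤ C) ∧ (∀ X ∈ H, ∑ i : Fin 3, (fderiv ℝ V X (e i)) i = 0) ∧ (∀ X ∈ H,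
      (fderiv ℝ V X) (V X) + gradient Q X = 0) ∧ (∀ X ∈ H, V ((2 : ℝ) • X) = V X ∧ Q ((2 : ℝ) • X)
      = Q X) ∧ (∀ X : EuclideanSpace ℝ (Fin 3), 1 ≤ X 2 → X 2 ≤ 2 → V (X + e 0) = V X ∧ V (X + e 1)
      = V X ∧ Q (X + e 0) = Q X ∧ Q (X + e 1) = Q X) ∧ (∫ q in Set.Icc (0 : ℝ) 1 ×ˢ Set.Icc (0 : ℝ)
      1, (V (pt q)) 2 = 0) ∧ F ≠ 0 ∧ (∫ q in Set.Icc (0 : ℝ) 1 ×ˢ Set.Icc (0 : ℝ) 1, (V (pt q)) 2 *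
      (‖V (pt q)‖ ^ 2 / 2 + Q (pt q)) = F)) → X) := by
  rw [without_blowdown_iff_hierarchy]

/-- **Structure check / what a disproof contains, consequent side.**  `DyadicRealisation`
unfolds by `rfl` to `ViscousWallProfile → CoherentStates.SteadyZerothLaw` (stmt-17919 → stmt-0219);
in particular any disproof of the crux proves the steady NEGATIVE `¬SteadyZerothLaw` — quiet steady
states for EVERY smooth force (the content of `CoherentStates.SteadyNeg`, stmt-0222) — on top of
exhibiting the profile.  (Term-mode proof `fun hD hZ => hD fun _ => hZ`: it elaborates only because
the consequent is stmt-0219 verbatim.) [folklore] -/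
theorem not_steadyZerothLaw_of_not_dyadicRealisation
    (hD : ¬ Summit.AnomalousDissipation.AnomalousDissipation.Theses.DyadicWallCascade.DyadicRealisation) :
    ¬ Summit.AnomalousDissipation.AnomalousDissipation.Theses.CoherentStates.SteadyZerothLaw :=
  fun hZ => hD fun _ => hZ

/-- **Instance `X := SteadyZerothLaw`**: the crux with `F ≠ 0` deleted is logically equivalent to
the shared open item stmt-0219 — the clause `F ≠ 0` is what makes the viscous-wall-profile
hypothesis worth anything to a prover. [folklore] -/
theorem without_fluxNonzero_iff_steadyZerothLaw :
    ((∃ (W : EuclideanSpace ℝ (Fin 3) → EuclideanSpace ℝ (Fin 3)) (P : EuclideanSpace ℝ (Fin 3) →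
    ℝ) (V : EuclideanSpace ℝ (Fin 3) → EuclideanSpace ℝ (Fin 3)) (Q : EuclideanSpace ℝ (Fin 3) → ℝ)
    (C F C' : ℝ),
      let H : Set (EuclideanSpace ℝ (Fin 3)) := {X | 0 < X 2};
      let e : Fin 3 → EuclideanSpace ℝ (Fin 3) := fun i => EuclideanSpace.single i (1 : ℝ);
      let pt : ℝ × ℝ → EuclideanSpace ℝ (Fin 3) := fun q => !₂[q.1, q.2, (1 : ℝ)];
      let σ : EuclideanSpace ℝ (Fin 3) → EuclideanSpace ℝ (Fin 3) := fun X => X - (2 * X 2) • e 2;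
      (ContDiffOn ℝ ((⊤ : ℕ∞) : WithTop ℕ∞) V H ∧ ContDiffOn ℝ ((⊤ : ℕ∞) : WithTop ℕ∞) Q H ∧ (∀ X ∈
      H, ‖V X‖ ≤ C ∧ |Q X| ≤ C) ∧ (∀ X ∈ H, ∑ i : Fin 3, (fderiv ℝ V X (e i)) i = 0) ∧ (∀ X ∈ H,
      (fderiv ℝ V X) (V X) + gradient Q X = 0) ∧ (∀ X ∈ H, V ((2 : ℝ) • X) = V X ∧ Q ((2 : ℝ) • X)
      = Q X) ∧ (∀ X : EuclideanSpace ℝ (Fin 3), 1 ≤ X 2 → X 2 ≤ 2 → V (X + e 0) = V X ∧ V (X + e 1)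
      = V X ∧ Q (X + e 0) = Q X ∧ Q (X + e 1) = Q X) ∧ (∫ q in Set.Icc (0 : ℝ) 1 ×ˢ Set.Icc (0 : ℝ)
      1, (V (pt q)) 2 = 0) ∧ (∫ q in Set.Icc (0 : ℝ) 1 ×ˢ Set.Icc (0 : ℝ) 1, (V (pt q)) 2 * (‖V (pt
      q)‖ ^ 2 / 2 + Q (pt q)) = F)) ∧ ContDiff ℝ ((⊤ : ℕ∞) : WithTop ℕ∞) W ∧ ContDiff ℝ ((⊤ : ℕ∞) :
      WithTop ℕ∞) P ∧ (∀ X, ‖W X‖ ≤ C' ∧ |P X| ≤ C') ∧ (∀ X, W (σ X) = σ (W X) ∧ P (σ X) = P X) ∧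
      (∀ X, ∑ i : Fin 3, (fderiv ℝ W X (e i)) i = 0) ∧ (∀ X, (fderiv ℝ W X) (W X) + gradient P X =
      ∑ i : Fin 3, fderiv ℝ (fun Y => fderiv ℝ W Y (e i)) X (e i)) ∧ (∀ ε : ℝ, 0 < ε → ∃ M : ℕ, ∀ m
      : ℕ, M ≤ m → ∀ X : EuclideanSpace ℝ (Fin 3), 1 ≤ X 2 → X 2 ≤ 2 → ‖W ((2 : ℝ) ^ m • X) - V X‖
      ≤ ε ∧ |P ((2 : ℝ) ^ m • X) - Q X| ≤ ε)) →
      Summit.AnomalousDissipation.AnomalousDissipation.Theses.CoherentStates.SteadyZerothLaw) ↔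
      Summit.AnomalousDissipation.AnomalousDissipation.Theses.CoherentStates.SteadyZerothLaw :=
  imp_iff_of_without_fluxNonzero _

/-- **Instance `X := SteadyZerothLaw`** for the energy-flux clause. [folklore] -/
theorem without_fluxIntegral_iff_steadyZerothLaw :
    ((∃ (W : EuclideanSpace ℝ (Fin 3) → EuclideanSpace ℝ (Fin 3)) (P : EuclideanSpace ℝ (Fin 3) →
    ℝ) (V : EuclideanSpace ℝ (Fin 3) → EuclideanSpace ℝ (Fin 3)) (Q : EuclideanSpace ℝ (Fin 3) → ℝ)
    (C F C' : ℝ),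
      let H : Set (EuclideanSpace ℝ (Fin 3)) := {X | 0 < X 2};
      let e : Fin 3 → EuclideanSpace ℝ (Fin 3) := fun i => EuclideanSpace.single i (1 : ℝ);
      let pt : ℝ × ℝ → EuclideanSpace ℝ (Fin 3) := fun q => !₂[q.1, q.2, (1 : ℝ)];
      let σ : EuclideanSpace ℝ (Fin 3) → EuclideanSpace ℝ (Fin 3) := fun X => X - (2 * X 2) • e 2;
      (ContDiffOn ℝ ((⊤ : ℕ∞) : WithTop ℕ∞) V H ∧ ContDiffOn ℝ ((⊤ : ℕ∞) : WithTop ℕ∞) Q H ∧ (∀ X ∈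
      H, ‖V X‖ ≤ C ∧ |Q X| ≤ C) ∧ (∀ X ∈ H, ∑ i : Fin 3, (fderiv ℝ V X (e i)) i = 0) ∧ (∀ X ∈ H,
      (fderiv ℝ V X) (V X) + gradient Q X = 0) ∧ (∀ X ∈ H, V ((2 : ℝ) • X) = V X ∧ Q ((2 : ℝ) • X)
      = Q X) ∧ (∀ X : EuclideanSpace ℝ (Fin 3), 1 ≤ X 2 → X 2 ≤ 2 → V (X + e 0) = V X ∧ V (X + e 1)
      = V X ∧ Q (X + e 0) = Q X ∧ Q (X + e 1) = Q X) ∧ (∫ q in Set.Icc (0 : ℝ) 1 ×ˢ Set.Icc (0 : ℝ)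
      1, (V (pt q)) 2 = 0) ∧ F ≠ 0) ∧ ContDiff ℝ ((⊤ : ℕ∞) : WithTop ℕ∞) W ∧ ContDiff ℝ ((⊤ : ℕ∞) :
      WithTop ℕ∞) P ∧ (∀ X, ‖W X‖ ≤ C' ∧ |P X| ≤ C') ∧ (∀ X, W (σ X) = σ (W X) ∧ P (σ X) = P X) ∧
      (∀ X, ∑ i : Fin 3, (fderiv ℝ W X (e i)) i = 0) ∧ (∀ X, (fderiv ℝ W X) (W X) + gradient P X =
      ∑ i : Fin 3, fderiv ℝ (fun Y => fderiv ℝ W Y (e i)) X (e i)) ∧ (∀ ε : ℝ, 0 < ε → ∃ M : ℕ, ∀ m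
      : ℕ, M ≤ m → ∀ X : EuclideanSpace ℝ (Fin 3), 1 ≤ X 2 → X 2 ≤ 2 → ‖W ((2 : ℝ) ^ m • X) - V X‖
      ≤ ε ∧ |P ((2 : ℝ) ^ m • X) - Q X| ≤ ε)) →
      Summit.AnomalousDissipation.AnomalousDissipation.Theses.CoherentStates.SteadyZerothLaw) ↔
      Summit.AnomalousDissipation.AnomalousDissipation.Theses.CoherentStates.SteadyZerothLaw :=
  imp_iff_of_without_fluxIntegral _

/-- **Instance `X := SteadyZerothLaw`** for the blow-down clause: the crux without it is, by
`rfl` on crux #2, `HalfSpaceHierarchy → SteadyZerothLaw`. [folklore] -/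
theorem without_blowdown_iff_hierarchy_imp_steadyZerothLaw :
    ((∃ (W : EuclideanSpace ℝ (Fin 3) → EuclideanSpace ℝ (Fin 3)) (P : EuclideanSpace ℝ (Fin 3) →
    ℝ) (V : EuclideanSpace ℝ (Fin 3) → EuclideanSpace ℝ (Fin 3)) (Q : EuclideanSpace ℝ (Fin 3) → ℝ)
    (C F C' : ℝ),
      let H : Set (EuclideanSpace ℝ (Fin 3)) := {X | 0 < X 2};
      let e : Fin 3 → EuclideanSpace ℝ (Fin 3) := fun i => EuclideanSpace.single i (1 : ℝ);
      let pt : ℝ × ℝ → EuclideanSpace ℝ (Fin 3) := fun q => !₂[q.1, q.2, (1 : ℝ)];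
      let σ : EuclideanSpace ℝ (Fin 3) → EuclideanSpace ℝ (Fin 3) := fun X => X - (2 * X 2) • e 2;
      (ContDiffOn ℝ ((⊤ : ℕ∞) : WithTop ℕ∞) V H ∧ ContDiffOn ℝ ((⊤ : ℕ∞) : WithTop ℕ∞) Q H ∧ (∀ X ∈
      H, ‖V X‖ ≤ C ∧ |Q X| ≤ C) ∧ (∀ X ∈ H, ∑ i : Fin 3, (fderiv ℝ V X (e i)) i = 0) ∧ (∀ X ∈ H,
      (fderiv ℝ V X) (V X) + gradient Q X = 0) ∧ (∀ X ∈ H, V ((2 : ℝ) • X) = V X ∧ Q ((2 : ℝ) • X)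
      = Q X) ∧ (∀ X : EuclideanSpace ℝ (Fin 3), 1 ≤ X 2 → X 2 ≤ 2 → V (X + e 0) = V X ∧ V (X + e 1)
      = V X ∧ Q (X + e 0) = Q X ∧ Q (X + e 1) = Q X) ∧ (∫ q in Set.Icc (0 : ℝ) 1 ×ˢ Set.Icc (0 : ℝ)
      1, (V (pt q)) 2 = 0) ∧ F ≠ 0 ∧ (∫ q in Set.Icc (0 : ℝ) 1 ×ˢ Set.Icc (0 : ℝ) 1, (V (pt q)) 2 *
      (‖V (pt q)‖ ^ 2 / 2 + Q (pt q)) = F)) ∧ ContDiff ℝ ((⊤ : ℕ∞) : WithTop ℕ∞) W ∧ ContDiff ℝ ((⊤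
      : ℕ∞) : WithTop ℕ∞) P ∧ (∀ X, ‖W X‖ ≤ C' ∧ |P X| ≤ C') ∧ (∀ X, W (σ X) = σ (W X) ∧ P (σ X) =
      P X) ∧ (∀ X, ∑ i : Fin 3, (fderiv ℝ W X (e i)) i = 0) ∧ (∀ X, (fderiv ℝ W X) (W X) + gradient
      P X = ∑ i : Fin 3, fderiv ℝ (fun Y => fderiv ℝ W Y (e i)) X (e i))) →
      Summit.AnomalousDissipation.AnomalousDissipation.Theses.CoherentStates.SteadyZerothLaw) ↔
      (Summit.AnomalousDissipation.AnomalousDissipation.Theses.DyadicWallCascade.HalfSpaceHierarchy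
      →
      Summit.AnomalousDissipation.AnomalousDissipation.Theses.CoherentStates.SteadyZerothLaw) :=
  imp_iff_of_without_blowdown _

/-! ### Two silent normalisations of the antecedent (cheap consequences of single clauses; no kill) -/

/-- **Free-slip wall.** The mirror clause alone (`W (σ X) = σ (W X)`, `σ` the reflection in the
plane `X₂ = 0`) forces `W₂ = 0` on the symmetry plane: restricted to the upper half-space the
profile is a bounded steady flow over a flat perfect-slip wall fed from infinity — the relevant
Liouville class is "bounded steady NS in the half-space with Navier (perfect-slip) boundary,
bounded pressure", for which the printed theorems all require decay, a Dirichlet-integral bound,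
axisymmetry or smallness (§7). [folklore] -/
theorem wallSlip_of_mirror {W : EuclideanSpace ℝ (Fin 3) → EuclideanSpace ℝ (Fin 3)}
    (hmir : ∀ X : EuclideanSpace ℝ (Fin 3),
      W (X - (2 * X 2) • EuclideanSpace.single (2 : Fin 3) (1 : ℝ)) =
        W X - (2 * (W X) 2) • EuclideanSpace.single (2 : Fin 3) (1 : ℝ))
    (X : EuclideanSpace ℝ (Fin 3)) (hX : X 2 = 0) : (W X) 2 = 0 := by
  have h := hmir X
  rw [hX, mul_zero, zero_smul, sub_zero] at h
  have h2 : (2 * (W X) 2) • EuclideanSpace.single (2 : Fin 3) (1 : ℝ) = 0 := sub_eq_self.1 h.symm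
  have h3 := congrArg (fun v : EuclideanSpace ℝ (Fin 3) => v 2) h2
  simpa using h3

/-- **Hidden half-period at the base of the band.** The band is CLOSED (`1 ≤ X₂ ≤ 2`), so the
plane `X₂ = 2` carries the unit period, and dilation transports it to the period `½` on `X₂ = 1`:
`V (X + ½e₀) = V X` there (likewise `e₁`).  Hence the unit square of the flux clauses holds four
minimal cells and `F = 4 F_cell`; a harmless normalisation (any witness of crux #2 has it), NOT a
kill — recorded so that nobody "discovers" it as an inconsistency. [folklore] -/
theorem halfPeriod_at_one {V : EuclideanSpace ℝ (Fin 3) → EuclideanSpace ℝ (Fin 3)}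
    (hdil : ∀ X : EuclideanSpace ℝ (Fin 3), 0 < X 2 → V ((2 : ℝ) • X) = V X)
    (hper : ∀ X : EuclideanSpace ℝ (Fin 3), 1 ≤ X 2 → X 2 ≤ 2 →
      V (X + EuclideanSpace.single (0 : Fin 3) (1 : ℝ)) = V X)
    (X : EuclideanSpace ℝ (Fin 3)) (hX : X 2 = 1) :
    V (X + (1 / 2 : ℝ) • EuclideanSpace.single (0 : Fin 3) (1 : ℝ)) = V X := by
  have hY2 : (X + (1 / 2 : ℝ) • EuclideanSpace.single (0 : Fin 3) (1 : ℝ)) 2 = 1 := by simp [hX]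
  have h2Y : (2 : ℝ) • (X + (1 / 2 : ℝ) • EuclideanSpace.single (0 : Fin 3) (1 : ℝ)) =
      (2 : ℝ) • X + EuclideanSpace.single (0 : Fin 3) (1 : ℝ) := by
    rw [smul_add, smul_smul]; norm_num
  have h2X2 : ((2 : ℝ) • X) 2 = 2 := by simp [hX]
  calc V (X + (1 / 2 : ℝ) • EuclideanSpace.single (0 : Fin 3) (1 : ℝ))
      = V ((2 : ℝ) • (X + (1 / 2 : ℝ) • EuclideanSpace.single (0 : Fin 3) (1 : ℝ))) :=
        (hdil _ (by rw [hY2]; norm_num)).symm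
    _ = V ((2 : ℝ) • X + EuclideanSpace.single (0 : Fin 3) (1 : ℝ)) := by rw [h2Y]
    _ = V ((2 : ℝ) • X) := hper _ (by rw [h2X2]; norm_num) (by rw [h2X2])
    _ = V X := hdil X (by rw [hX]; norm_num)

end DyadicWallCascadeNegative

end Summit.AnomalousDissipation.AnomalousDissipation.Theorems
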